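import Summits.NavierStokesRegularity.NavierStokesRegularity.Theorems.OddMorawetzMorawetzKillsTypeINullTransfer
import Summits.NavierStokesRegularity.NavierStokesRegularity.Theorems.OddMorawetzMorawetzKillsTypeIJetCalculus
import Summits.NavierStokesRegularity.NavierStokesRegularity.Theorems.OddMorawetzMorawetzKillsTypeIIsoStructureThreeFrame

/-!
# Crux `MorawetzKillsTypeI` — frame for the weight-3 null-Lagrangian certificates (`stub_isoNullThree`)

The registered stub `stub_isoNullThree` (crux stmt-NavierStokesRegularity-1377, line `registered`) says that each of
the seventeen `δ`-contractions `I_l` of weight 3, corrected by `α_l r` (`r = ω · ∇u ω`), has Euler derivative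
orthogonal to `B(v,v)` along divergence-free Schwartz fields. The mechanism: `I_l - α_l r` is, on the jets of smooth
divergence-free fields, a TOTAL DIVERGENCE `div (F_l ∘ J)` of a polynomial flux `F_l` of the 2-jet, and
`stub_nullTransfer` turns that into the integral identity. This hand-written frame isolates the one analytic step,
`integral_zero_of_flux`: if the flux components are given as continuous trilinear forms `M c` on `Jet3` (evaluated on
the diagonal) which do not see the third-order component, and the density `P` agrees, on every symmetric jet with
trace-free first slots, with the FORMAL divergence `∑ᵢ (M i (∂ᵢz, z, z) + M i (z, ∂ᵢz, z) + M i (z, z, ∂ᵢz))`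
(`∂ᵢ z = jshift i z`), then `∫ fderiv P (J v) (J (B(v,v))) = 0` for all divergence-free Schwartz `v`. The generated
files then only prove polynomial identities. Also here: the product trilinear form `jmono f g h` written out, the
shift rules `jcU/jcA/jcH ∘ jshift`, and smoothness of coordinate polynomials. Everything is proved; no definitions.
-/

noncomputable section

open scoped BigOperators

set_option linter.dupNamespace false

namespace Summit.NavierStokesRegularity.NavierStokesRegularity.Theorems

open Literature.Analysis.FluidPDE
open Summit.NavierStokesRegularity.NavierStokesRegularity.Theorems.OddMorawetz

namespace IsoNullThree

/-! ### The diagonal of a trilinear form: smoothness and derivative -/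

/-- `update (fun _ => z) s w` as vector literals. -/
theorem update_diag (z w : Jet3) :
    Function.update (fun _ : Fin 3 => z) 0 w = ![w, z, z] ∧ Function.update (fun _ : Fin 3 => z) 1 w = ![z, w, z] ∧
      Function.update (fun _ : Fin 3 => z) 2 w = ![z, z, w] := by
  refine ⟨?_, ?_, ?_⟩ <;> funext s <;> fin_cases s <;> simp

/-- The diagonal `z ↦ M(z, z, z)` of a continuous trilinear form is smooth. -/
theorem contDiff_diag (M : Jet3 [×3]→L[ℝ] ℝ) : ContDiff ℝ (⊤ : ℕ∞) (fun z : Jet3 => M (fun _ : Fin 3 => z)) :=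
  M.contDiff.comp (contDiff_pi.2 fun _ => contDiff_id)

/-- Derivative of the diagonal of a continuous trilinear form. -/
theorem hasFDerivAt_diag (M : Jet3 [×3]→L[ℝ] ℝ) (z : Jet3) :
    HasFDerivAt (fun z : Jet3 => M (fun _ : Fin 3 => z))
      ((M.linearDeriv (fun _ => z)).comp (ContinuousLinearMap.pi fun _ : Fin 3 => ContinuousLinearMap.id ℝ Jet3)) z :=
  (M.hasFDerivAt (fun _ => z)).comp z (hasFDerivAt_pi.2 fun _ => hasFDerivAt_id z)

/-- The derivative of the diagonal, evaluated: `D(M(z,z,z)) w = M(w,z,z) + M(z,w,z) + M(z,z,w)`. -/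
theorem fderiv_diag_apply (M : Jet3 [×3]→L[ℝ] ℝ) (z w : Jet3) :
    fderiv ℝ (fun z : Jet3 => M (fun _ : Fin 3 => z)) z w = M ![w, z, z] + M ![z, w, z] + M ![z, z, w] := by
  rw [(hasFDerivAt_diag M z).fderiv]
  obtain ⟨h0, h1, h2⟩ := update_diag z w
  simp only [ContinuousLinearMap.comp_apply, ContinuousLinearMap.pi_apply, ContinuousLinearMap.id_apply,
    ContinuousMultilinearMap.linearDeriv_apply, Fin.sum_univ_three, Fin.isValue, h0, h1, h2]

/-! ### Fluxes with trilinear components -/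

variable (M : Fin 3 → Jet3 [×3]→L[ℝ] ℝ)

/-- The flux `F z = ∑_c M_c(z,z,z) e_c` is smooth. -/
theorem contDiff_flux :
    ContDiff ℝ (⊤ : ℕ∞) (fun z : Jet3 => ∑ c : Fin 3, M c (fun _ : Fin 3 => z) • EuclideanSpace.single c (1 : ℝ)) :=
  ContDiff.sum fun c _ => (contDiff_diag (M c)).smul contDiff_const

/-- Components of the derivative of the flux. -/
theorem fderiv_flux_apply (z w : Jet3) (i : Fin 3) :
    fderiv ℝ (fun z : Jet3 => ∑ c : Fin 3, M c (fun _ : Fin 3 => z) • EuclideanSpace.single c (1 : ℝ)) z w i =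
      M i ![w, z, z] + M i ![z, w, z] + M i ![z, z, w] := by
  have h : HasFDerivAt (fun z : Jet3 => ∑ c : Fin 3, M c (fun _ : Fin 3 => z) • EuclideanSpace.single c (1 : ℝ))
      (∑ c : Fin 3, ((M c).linearDeriv (fun _ => z) |>.comp
        (ContinuousLinearMap.pi fun _ : Fin 3 => ContinuousLinearMap.id ℝ Jet3)).smulRight
          (EuclideanSpace.single c (1 : ℝ))) z :=
    HasFDerivAt.fun_sum fun c _ => (hasFDerivAt_diag (M c) z).smul_const _
  rw [h.fderiv, ← fderiv_diag_apply, (hasFDerivAt_diag (M i) z).fderiv]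
  fin_cases i <;> simp [Fin.sum_univ_three]

/-- **Frame theorem.** If `P` is smooth and agrees, on symmetric jets with trace-free slots, with the formal
divergence of a flux with trilinear components `M c` that do not see the third-order slot, then the Euler pairing of
`P` with `B(v,v)` integrates to zero along every divergence-free Schwartz field `v` (`stub_nullTransfer` +
`stub_jetCalculus`). -/
theorem integral_zero_of_flux (P : Jet3 → ℝ) (hP : ContDiff ℝ (⊤ : ℕ∞) P)
    (hM : ∀ (c : Fin 3) (z : Jet3) (t : E3 [×3]→L[ℝ] E3),
      M c (fun _ => ((z.1, z.2.1, z.2.2.1, t) : Jet3)) = M c (fun _ => ((z.1, z.2.1, z.2.2.1, 0) : Jet3)))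
    (hid : ∀ z : Jet3,
      (∀ (h : Fin 2 → E3) (σ : Equiv.Perm (Fin 2)), z.2.2.1 (h ∘ σ) = z.2.2.1 h) →
      (∀ (h : Fin 3 → E3) (σ : Equiv.Perm (Fin 3)), z.2.2.2 (h ∘ σ) = z.2.2.2 h) →
      (∑ a : Fin 3, jcA a a z = 0) → (∀ j : Fin 3, ∑ a : Fin 3, jcH a a j z = 0) →
      (∀ j k : Fin 3, ∑ a : Fin 3, jcT a a j k z = 0) →
      P z = ∑ i : Fin 3, (M i ![jshift i z, z, z] + M i ![z, jshift i z, z] + M i ![z, z, jshift i z])) :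
    ∀ v : E3 → E3, IsSchwartzField v → VectorCalculus.IsDivFree v →
      ∫ x, fderiv ℝ P ((v x, iteratedFDeriv ℝ 1 v x, iteratedFDeriv ℝ 2 v x, iteratedFDeriv ℝ 3 v x) : Jet3)
        ((eulerBilinear v v x, iteratedFDeriv ℝ 1 (eulerBilinear v v) x, iteratedFDeriv ℝ 2 (eulerBilinear v v) x,
          iteratedFDeriv ℝ 3 (eulerBilinear v v) x) : Jet3) = 0 := by
  intro v hv hdiv
  set F : Jet3 → E3 := fun z => ∑ c : Fin 3, M c (fun _ : Fin 3 => z) • EuclideanSpace.single c (1 : ℝ) with hFdef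
  have hF : ContDiff ℝ (⊤ : ℕ∞) F := contDiff_flux M
  refine stub_nullTransfer P F hP hF ?_ v hv hdiv
  intro w hw hwdiv x
  rw [JetCalculus.divergence_flux F (hF.of_le (by exact_mod_cast le_top)) hw x]
  set z : Jet3 := ((w x, iteratedFDeriv ℝ 1 w x, iteratedFDeriv ℝ 2 w x, iteratedFDeriv ℝ 3 w x) : Jet3) with hz
  -- replace the direction `∂ᵢ (J w)` by the formal shift
  have hind : ∀ (z' : Jet3) (t : E3 [×3]→L[ℝ] E3), F (z'.1, z'.2.1, z'.2.2.1, t) = F (z'.1, z'.2.1, z'.2.2.1, 0) := by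
    intro z' t
    simp only [hFdef, hM]
  have hdir : ∀ i : Fin 3,
      fderiv ℝ F z (fderiv ℝ (fun y => ((w y, iteratedFDeriv ℝ 1 w y, iteratedFDeriv ℝ 2 w y, iteratedFDeriv ℝ 3 w y) : Jet3))
        x (EuclideanSpace.single i (1 : ℝ))) = fderiv ℝ F z (jshift i z) := by
    intro i
    obtain ⟨h1, h2, h3⟩ := JetCalculus.fderiv_jet_components hw x (EuclideanSpace.single i (1 : ℝ))
    exact JetCalculus.fderiv_indep_top F (hF.differentiable (by simp)) hind z _ _
      (by rw [h1]; rfl) (by rw [h2]; rfl) (by rw [h3]; rfl)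
  obtain ⟨hA, hH, hT⟩ := JetCalculus.trace_free hw hwdiv x
  obtain ⟨hs2, hs3⟩ := JetCalculus.jet_symm hw x
  rw [hid z hs2 hs3 hA hH hT]
  refine Finset.sum_congr rfl fun i _ => ?_
  rw [hdir i, hFdef, fderiv_flux_apply]

/-! ### Product trilinear forms and the formal shift in coordinates -/

/-- The product form `(f ⊗ g ⊗ h)(x₀, x₁, x₂) = f x₀ · g x₁ · h x₂`. -/
theorem jmono_apply (f g h : Jet3 →L[ℝ] ℝ) (x : Fin 3 → Jet3) :
    (ContinuousMultilinearMap.mkPiAlgebra ℝ (Fin 3) ℝ).compContinuousLinearMap ![f, g, h] x =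
      f (x 0) * g (x 1) * h (x 2) := by
  simp only [ContinuousMultilinearMap.compContinuousLinearMap_apply, ContinuousMultilinearMap.mkPiAlgebra_apply,
    Fin.prod_univ_three, Fin.isValue, Matrix.cons_val_zero, Matrix.cons_val_one, Matrix.cons_val_two, Matrix.head_cons,
    Matrix.tail_cons]

/-- The formal shift in coordinates: `u_a ∘ ∂ᵢ = A_{a i}`, `A_{ab} ∘ ∂ᵢ = H_{a i b}`, `H_{abc} ∘ ∂ᵢ = T_{a i b c}`. -/
theorem shift_coord (i : Fin 3) (z : Jet3) :
    (∀ a : Fin 3, jcU a (jshift i z) = jcA a i z) ∧ (∀ a b : Fin 3, jcA a b (jshift i z) = jcH a i b z) ∧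
      (∀ a b c : Fin 3, jcH a b c (jshift i z) = jcT a i b c z) := by
  refine ⟨fun a => rfl, fun a b => ?_, fun a b c => ?_⟩
  · have e2 : (Fin.cons (EuclideanSpace.single i (1 : ℝ)) (fun _ : Fin 1 => EuclideanSpace.single b (1 : ℝ)) :
        Fin 2 → E3) = ![EuclideanSpace.single i (1 : ℝ), EuclideanSpace.single b (1 : ℝ)] := by
      funext s; fin_cases s <;> rfl
    rw [jcA_apply, jshift_snd_fst_apply, e2, jcH_apply]
  · rw [jcH_apply, jshift_snd_snd_fst_apply, jcT_apply]
    rfl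

/-- The coordinates do not see the third-order slot. -/
theorem coord_indep_top (z : Jet3) (t : E3 [×3]→L[ℝ] E3) :
    (∀ a : Fin 3, jcU a ((z.1, z.2.1, z.2.2.1, t) : Jet3) = jcU a z) ∧
    (∀ a b : Fin 3, jcA a b ((z.1, z.2.1, z.2.2.1, t) : Jet3) = jcA a b z) ∧
    (∀ a b c : Fin 3, jcH a b c ((z.1, z.2.1, z.2.2.1, t) : Jet3) = jcH a b c z) :=
  ⟨fun _ => rfl, fun _ _ => rfl, fun _ _ _ => rfl⟩

/-- Vector literal slots. -/
theorem vec3_apply (x y w : Jet3) : (![x, y, w] : Fin 3 → Jet3) 0 = x ∧ (![x, y, w] : Fin 3 → Jet3) 1 = y ∧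
    (![x, y, w] : Fin 3 → Jet3) 2 = w := ⟨rfl, rfl, rfl⟩

/-! ### Smoothness of coordinate polynomials -/

/-- A triple sum of products of three coordinate functionals is smooth. -/
theorem contDiff_sum3 (f g h : Fin 3 → Fin 3 → Fin 3 → (Jet3 →L[ℝ] ℝ)) (n : ℕ∞) :
    ContDiff ℝ n (fun z : Jet3 => ∑ i0 : Fin 3, ∑ i1 : Fin 3, ∑ i2 : Fin 3, f i0 i1 i2 z * g i0 i1 i2 z * h i0 i1 i2 z) :=
  ContDiff.sum fun i0 _ => ContDiff.sum fun i1 _ => ContDiff.sum fun i2 _ =>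
    (((f i0 i1 i2).contDiff.mul (g i0 i1 i2).contDiff).mul (h i0 i1 i2).contDiff)

/-! ### Registration hook (crux stmt-NavierStokesRegularity-1377, stub `stub_isoNullThree`) -/

/-- **Frame theorem** (hook form, every hypothesis after the colon): a smooth density that agrees on symmetric,
trace-free jets with the formal divergence of a flux with trilinear components not seeing the third-order slot has
Euler pairing with `B(v,v)` of integral zero along divergence-free Schwartz fields. -/
theorem isoNullThree_flux : ∀ (M : Fin 3 → Jet3 [×3]→L[ℝ] ℝ) (P : Jet3 → ℝ), ContDiff ℝ (⊤ : ℕ∞) P →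
    (∀ (c : Fin 3) (z : Jet3) (t : E3 [×3]→L[ℝ] E3),
      M c (fun _ => ((z.1, z.2.1, z.2.2.1, t) : Jet3)) = M c (fun _ => ((z.1, z.2.1, z.2.2.1, 0) : Jet3))) →
    (∀ z : Jet3,
      (∀ (h : Fin 2 → E3) (σ : Equiv.Perm (Fin 2)), z.2.2.1 (h ∘ σ) = z.2.2.1 h) →
      (∀ (h : Fin 3 → E3) (σ : Equiv.Perm (Fin 3)), z.2.2.2 (h ∘ σ) = z.2.2.2 h) →
      (∑ a : Fin 3, jcA a a z = 0) → (∀ j : Fin 3, ∑ a : Fin 3, jcH a a j z = 0) →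
      (∀ j k : Fin 3, ∑ a : Fin 3, jcT a a j k z = 0) →
      P z = ∑ i : Fin 3, (M i ![jshift i z, z, z] + M i ![z, jshift i z, z] + M i ![z, z, jshift i z])) →
    ∀ v : E3 → E3, Literature.Analysis.FluidPDE.IsSchwartzField v →
      Literature.Analysis.FluidPDE.VectorCalculus.IsDivFree v →
      ∫ x, fderiv ℝ P ((v x, iteratedFDeriv ℝ 1 v x, iteratedFDeriv ℝ 2 v x, iteratedFDeriv ℝ 3 v x) : Jet3)
        ((Literature.Analysis.FluidPDE.eulerBilinear v v x, iteratedFDeriv ℝ 1 (Literature.Analysis.FluidPDE.eulerBilinear v v) x,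
          iteratedFDeriv ℝ 2 (Literature.Analysis.FluidPDE.eulerBilinear v v) x,
          iteratedFDeriv ℝ 3 (Literature.Analysis.FluidPDE.eulerBilinear v v) x) : Jet3) = 0 :=
  fun M P hP hM hid => integral_zero_of_flux M P hP hM hid

end IsoNullThree

end Summit.NavierStokesRegularity.NavierStokesRegularity.Theorems

end
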